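import Summits.Ventures.AbcSig.Rows.XTemplateBC245
import Summits.Ventures.AbcSig.Rows.XTemplateBC
import Summits.Ventures.AbcSig.Levels.N1352
import Summits.Ventures.AbcSig.Levels.N338

/-!
# Venture AbcSig — ROW `Xn45Yn13Z2`: `xⁿ + 2^α yⁿ = 13 z²` for `α ∈ {4, 5} (FAMILY C1b; GENERATED by p-lean gen3/leanrow_c1b245.py)

HONEST FRAMING. A row of a COMPUTATION cell (`pub-abcsig`); a CONDITIONAL theorem, no claim on ABC or any summit.
Hypotheses: `BS04Package` (CITED: [BS04] Lemma 3.3 + (3.1) + Lemma 4.2), `DataComplete` at the levels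
1352 = 8·13² (`y` odd, case (iv)₄₅) and 338 = 2·13² (`y` even, case (v₇))
(COMPUTED, certified level files), `Refines…` of kernel module certificates (COMPUTED) if any, and the listed per-orbit
exclusions `hX_…` (CITED; the row of record's R3/R5 name the module / printed argument per orbit). Everything else is
kernel-checked (`Rows/XTemplateBC245.lean`, `Rows/XTemplateBC.lean`, `Levels/N….lean`).
Exponent range: prime `n ≥ 11`, n ∉ [13]; `x·y ≠ ±1`.
Row of record: `census/rows/C1b/C1b-C13-a45.md` (sha16 `b7bf92d611356436`; R8-signed by referee ref-g20, 2026-08-22T23:18Z); p1's statement of record: the conjunct `Rows.C1bCell 13 (fun _ α => α = 4 ∨ α = 5) 11 ∅` of `Rows.C1bSmallAlphaSigned`. Level 1352 = 8·13² generated on the hub from the census Sturm file (c5′ cited); no residual exponent ≥ 11 survives the kernel sieve at either level, so the statement carries NO per-orbit cited hypothesis.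
-/

namespace Summit.Ventures.AbcSig

/-- Row `Xn45Yn13Z2`: no primitive solution of `xⁿ + 2^α yⁿ = 13 z²` for `α ∈ {4, 5} with `x·y ≠ ±1` for prime `n ≥ 11`, `n ∉ [13]`,
conditional on the named hypotheses. -/
theorem xrow_Xn45Yn13Z2 (M : NewformModel) (hP : M.BS04Package)
    (hD1352 : M.DataComplete 1352 level1352Orbits) (hD338 : M.DataComplete 338 level338Orbits)
    (n : ℕ) (hn : n.Prime) (hmin : 11 ≤ n) (hres : n ∉ ([13] : List ℕ)) (α : ℕ) (hα : α = 4 ∨ α = 5)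
    (x y z : ℤ) (hxy1 : x * y ≠ 1) (hxy2 : x * y ≠ -1) : ¬ IsPrimitiveSolution 1 (2 ^ α) 13 n x y z := by
  have h7 : 7 ≤ n := by omega
  have hC : Nat.Prime 13 := by norm_num
  have hsq : Squarefree (13 : ℕ) := (Nat.prime_iff.mp hC).squarefree
  have hnC : ¬ n ∣ 13 := by
    intro h
    simp only [List.mem_cons, List.not_mem_nil, or_false] at hres; rcases (Nat.dvd_prime hC).mp h with h1 | h1 <;> omega
  by_cases hy : 2 ∣ y
  · exact xbranchBC_v7 α 13 hsq (by decide) M hP hD338 n hn h7 hnC (by omega)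
      (level338_sieve n hn h7 (fun o => M.Excludes 338 o
      (famBC α 13 n (fun _ b => 2 ∣ b)) ∨ M.ExcludesStd 338 o n) (fun hmem => by
      obtain rfl : n = 7 := by simpa using hmem
      omega) (fun hmem => by
      obtain rfl : n = 7 := by simpa using hmem
      omega) (fun hmem => by
      obtain rfl : n = 7 := by simpa using hmem
      omega) (fun hmem => by
      obtain rfl : n = 13 := by simpa using hmem
      exact absurd (by simp) hres) (fun hmem => by
      obtain rfl : n = 13 := by simpa using hmem
      exact absurd (by simp) hres))
      x y z hy hxy1 hxy2
  · exact xbranchBC_iv45 α 13 hα hsq (by decide) M hP hD1352 n hn h7 hnC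
      (level1352_sieve n hn h7 (fun o => M.Excludes 1352 o
      (famBC α 13 n (fun _ b => ¬ 2 ∣ b)) ∨ M.ExcludesStd 1352 o n))
      x y z hy hxy1 hxy2

end Summit.Ventures.AbcSig
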